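import Mathlib.Combinatorics.SetFamily.Compression.Down
import Mathlib.Tactic
import HarnessLib
import HarnessLib.Audit.Tags
import Summits.CriticalPhenomena.PercolationContinuityZ3.Theorems.PercNearOneGluingNoHeavyLowerTailSahiRainbowStrictTwins

/-!
# The strict rainbow lemma, VII: the THREE-FAMILY twin inequality (typed conjecture)

Support file (seat `prim-masterthm-p1`, gen 40; `--supports stmt-CriticalPhenomena-4575`).  One typed conjecture and its relation to the rainbow lemma in
the degenerate direction; no `sorry`, standard axioms.  Memo `run/shared/lean/prim/prim-masterthm/FROM-prim-masterthm-p1-g40-STRICT-RAINBOW.md` §8.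

At a pinned point `z` of a complement-free family `P ⊆ 2^F` (`G = F.erase z`) three families of `G`-sets carry the twins: the doubled members `Q`
(complement-free in `G`), and the complement-closed families `V₀` (both endpoints of the near-complementary pairs of type C0) and `V₁` (type C1);
`Q, V₀, V₁` are pairwise disjoint, and ALL of `{∅} ∪ meets(Q ∪ V₁) ∪ co-joins(Q ∪ V₀)` are twins (memo §7).  The inequality below therefore implies the
twin count `tw_z ≥ k_z + m_z` whenever `k_z + m_z ≥ 3` (`…SahiRainbowStrictTwins`).

* `ThreeFamilyTwin` (typed, [status: open]): for `Q` complement-free in `G` and `U₀, U₁` with `V_i = U_i ∪ {G \ u : u ∈ U_i}`, the three families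
  `Q, V₀, V₁` pairwise disjoint and `U_i ∩ σU_i = ∅`:  `#({∅} ∪ meets (Q ∪ V₁) ∪ cojoins_G (Q ∪ V₀)) ≥ #Q + #U₀ + #U₁` provided `#Q + #U₀ + #U₁ ≥ 3`
  (for total load ≤ 2 the bound holds with `− 1`, attained).  EVIDENCE (`prim-masterthm-p1/code-g40/c/psi*.c`): exhaustive over all configurations on
  ground sets of size ≤ 4 (390 624 on 4 points), 1.2·10⁷ sampled configurations on 5 points and 6·10⁶ on 6 points: 0 violations; tight cases exist
  (small mixed configurations with `∅`/`G` among the sets).  Faces: `U₀ = U₁ = ∅` is the (weak) rainbow lemma for `Q` (`threeFamilyTwin_faceQ_iff`);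
  `Q = U₀ = ∅` is Marica–Schönheim for `U₁` (the meets of `V₁` contain all differences `u \ u'`).
HONEST FRAMING: `ThreeFamilyTwin` generalises `RainbowMeetCojoin` (it is not a reduction to something weaker); its value is as the candidate INDUCTIVE
statement for the compression argument, all of whose faces are classical. [this work]
-/

namespace Summit.CriticalPhenomena.PercolationContinuityZ3.Theorems.SahiColouredDaykin

open Finset

variable {α : Type*} [DecidableEq α]

/-- **CONJECTURE (three-family twin inequality; typed).**  See the file header. [this work] [status: open] -/
@[conjecture] def ThreeFamilyTwin (α : Type*) [DecidableEq α] : Prop :=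
  ∀ (G : Finset α) (Q U₀ U₁ : Finset (Finset α)),
    (∀ x ∈ Q ∪ U₀ ∪ U₁, x ⊆ G) →
    (∀ q ∈ Q, G \ q ∉ Q) → (∀ u ∈ U₀, G \ u ∉ U₀) → (∀ u ∈ U₁, G \ u ∉ U₁) →
    Disjoint Q (U₀ ∪ U₀.image (G \ ·)) → Disjoint Q (U₁ ∪ U₁.image (G \ ·)) →
    Disjoint (U₀ ∪ U₀.image (G \ ·)) (U₁ ∪ U₁.image (G \ ·)) →
    3 ≤ #Q + #U₀ + #U₁ →
    #Q + #U₀ + #U₁ ≤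
      #(insert ∅ (((Q ∪ (U₁ ∪ U₁.image (G \ ·))).offDiag.image fun p => p.1 ∩ p.2) ∪
        ((Q ∪ (U₀ ∪ U₀.image (G \ ·))).offDiag.image fun p => G \ (p.1 ∪ p.2))))

/-- The face `U₀ = U₁ = ∅` of `ThreeFamilyTwin` is the rainbow inequality for `Q` (with at least three members): the colour set there is
literally `rainbowMeets G Q`. [this work] -/
theorem threeFamilyTwin_faceQ_eq (G : Finset α) (Q : Finset (Finset α)) :
    insert ∅ (((Q ∪ ((∅ : Finset (Finset α)) ∪ (∅ : Finset (Finset α)).image (G \ ·))).offDiag.image fun p => p.1 ∩ p.2) ∪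
        ((Q ∪ ((∅ : Finset (Finset α)) ∪ (∅ : Finset (Finset α)).image (G \ ·))).offDiag.image fun p => G \ (p.1 ∪ p.2))) =
      rainbowMeets G Q := by
  rw [image_empty, union_empty, union_empty]; rfl

/-- Consequently the rainbow lemma gives the face `U₀ = U₁ = ∅` of `ThreeFamilyTwin`. [this work] -/
theorem threeFamilyTwin_faceQ_of_rainbowMeetCojoin (h : RainbowMeetCojoin α) (G : Finset α) (Q : Finset (Finset α))
    (hQG : ∀ q ∈ Q, q ⊆ G) (hcf : ∀ q ∈ Q, G \ q ∉ Q) :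
    #Q + #(∅ : Finset (Finset α)) + #(∅ : Finset (Finset α)) ≤
      #(insert ∅ (((Q ∪ ((∅ : Finset (Finset α)) ∪ (∅ : Finset (Finset α)).image (G \ ·))).offDiag.image fun p => p.1 ∩ p.2) ∪
        ((Q ∪ ((∅ : Finset (Finset α)) ∪ (∅ : Finset (Finset α)).image (G \ ·))).offDiag.image fun p => G \ (p.1 ∪ p.2)))) := by
  rw [threeFamilyTwin_faceQ_eq, card_empty, add_zero, add_zero]
  exact h G Q hQG hcf

end Summit.CriticalPhenomena.PercolationContinuityZ3.Theorems.SahiColouredDaykin
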